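import Summits.HodgeConjecture.HodgeCM.PerL34.RestrictedMeasure_1

/-! PORT of `HodgeCM/PerL34/RestrictedMeasure.lean` (HodgeCMPerL run 82) — part 2: continuation of `Summits.HodgeConjecture.HodgeCM.PerL34.RestrictedMeasure_1` (split at a top-level declaration boundary by port_pkg.py; scope re-opened below; declarations unchanged). -/

-- port_pkg: scope re-opened for this part (file-level context, then the namespace/section stack open at the cut)
set_option autoImplicit false
noncomputable section
open MeasureTheory Filter Set Function
open scoped Classical ENNReal
namespace HodgeCM.PerL34.RestrictedMeasure
universe u v
variable {ι : Type u} {G : ι → Type v} [∀ i, MeasurableSpace (G i)]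
variable (K : ∀ i, Set (G i)) (ν : ∀ i, Measure (G i))
section level
variable [Countable ι] [∀ i, SigmaFinite (ν i)]
/-- **Compatibility of the levels**: for `S₀ ⊆ S ⊆ S'`, `λ_{S'}|_{A_S} = λ_S`. -/
theorem level_restrict_box (hKm : ∀ i, MeasurableSet (K i)) {S₀ S S' : Finset ι}
    (hK1 : ∀ i, i ∉ S₀ → ν i (K i) = 1) (h₀ : S₀ ⊆ S) (h : S ⊆ S') :
    (level K ν S').restrict (box K S) = level K ν S := by
  have hpS : ∀ i, i ∉ S → IsProbabilityMeasure (locK K ν i) := fun i hi =>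
    isProbabilityMeasure_locK K ν (hK1 i fun h' => hi (h₀ h'))
  have hpS' : ∀ i, i ∉ S' → IsProbabilityMeasure (locK K ν i) := fun i hi => hpS i fun h' => hi (h h')
  symm
  refine ext_of_boxes ν S (level_spanningBox_ne_top K ν S hpS) (fun t ht s hs => ?_)
  · -- replace `A_S` by the finitely supported box `∏_{i ∈ S' \ S} K_i`, equal to it `λ_{S'}`-a.e.
    set kf : ∀ i, Set (G i) := fun i => if i ∈ S' \ S then K i else univ with hkf
    have hkfm : ∀ i, MeasurableSet (kf i) := fun i => by
      simp only [hkf]; split_ifs; exacts [hKm i, MeasurableSet.univ]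
    have hset : box K S =ᵐ[level K ν S'] (Set.pi univ kf : Set (Π i, G i)) := by
      refine Filter.eventuallyEq_set.2 ?_
      filter_upwards [ae_level_mem_box K ν hKm S' hpS'] with x hx
      change (∀ i, i ∉ S → x i ∈ K i) ↔ (∀ i, i ∈ (univ : Set ι) → x i ∈ kf i)
      refine ⟨fun hb i _ => ?_, fun hb i hi => ?_⟩
      · rw [hkf]; dsimp only
        split_ifs with hi
        · exact hb i (Finset.mem_sdiff.1 hi).2
        · exact mem_univ _
      · by_cases hi' : i ∈ S'
        · have := hb i (mem_univ _)
          rw [hkf] at this; dsimp only at this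
          rw [if_pos (Finset.mem_sdiff.2 ⟨hi', hi⟩)] at this
          exact this
        · exact hx i hi'
    rw [Measure.restrict_congr_set hset, Measure.restrict_apply (MeasurableSet.univ_pi ht),
      ← Set.pi_inter_distrib,
      level_pi K ν S' hpS' (t := fun i => t i ∩ kf i) (fun i => (ht i).inter (hkfm i))
        (s := s ∪ S') (fun i hi => ?_),
      level_pi K ν S hpS ht hs]
    · -- the finite bookkeeping
      have e1 : ∏ i ∈ S', ν i (t i ∩ kf i) =
          (∏ i ∈ S' \ S, locK K ν i (t i)) * ∏ i ∈ S, ν i (t i) := by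
        rw [← Finset.prod_sdiff h]
        congr 1
        · refine Finset.prod_congr rfl fun i hi => ?_
          rw [hkf]; dsimp only; rw [if_pos hi, locK, Measure.restrict_apply (ht i)]
        · refine Finset.prod_congr rfl fun i hi => ?_
          have : i ∉ S' \ S := fun h' => (Finset.mem_sdiff.1 h').2 hi
          rw [hkf]; dsimp only; rw [if_neg this, inter_univ]
      have e2 : ∏ i ∈ (s ∪ S') \ S', locK K ν i (t i ∩ kf i) = ∏ i ∈ s \ S', locK K ν i (t i) := by
        have : (s ∪ S') \ S' = s \ S' := by
          ext i; simp only [Finset.mem_sdiff, Finset.mem_union]; tauto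
        rw [this]
        refine Finset.prod_congr rfl fun i hi => ?_
        have hi' : i ∉ S' \ S := fun h' => (Finset.mem_sdiff.1 hi).2 (Finset.mem_sdiff.1 h').1
        rw [hkf]; dsimp only; rw [if_neg hi', inter_univ]
      have e3 : ∏ i ∈ s \ S, locK K ν i (t i) = ∏ i ∈ (s ∪ S') \ S, locK K ν i (t i) := by
        refine Finset.prod_subset (fun i hi => ?_) (fun i hi hi' => ?_)
        · rw [Finset.mem_sdiff] at hi ⊢
          exact ⟨Finset.mem_union_left _ hi.1, hi.2⟩
        · rw [Finset.mem_sdiff, Finset.mem_union] at hi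
          rw [Finset.mem_sdiff, not_and_or, not_not] at hi'
          have his : i ∉ s := fun h' => by rcases hi' with h'' | h'' <;> [exact h'' h'; exact hi.2 h'']
          haveI := hpS i hi.2
          rw [hs i his, measure_univ]
      have e4 : (s ∪ S') \ S = (S' \ S) ∪ (s \ S') := by
        ext i; simp only [Finset.mem_sdiff, Finset.mem_union]
        constructor
        · rintro ⟨h1 | h1, h2⟩
          · by_cases h3 : i ∈ S'
            · exact Or.inl ⟨h3, h2⟩
            · exact Or.inr ⟨h1, h3⟩
          · exact Or.inl ⟨h1, h2⟩
        · rintro (⟨h1, h2⟩ | ⟨h1, h2⟩)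
          · exact ⟨Or.inr h1, h2⟩
          · exact ⟨Or.inl h1, fun h3 => h2 (h h3)⟩
      have e5 : Disjoint (S' \ S) (s \ S') :=
        Finset.disjoint_left.2 fun i h1 h2 => (Finset.mem_sdiff.1 h2).2 (Finset.mem_sdiff.1 h1).1
      rw [e1, e2, e3, e4, Finset.prod_union e5]
      ring
    · rw [Finset.mem_union, not_or] at hi
      have : i ∉ S' \ S := fun h' => hi.2 (Finset.mem_sdiff.1 h').1
      rw [hkf]; dsimp only; rw [if_neg this, hs i hi.1, univ_inter]

end level

/-! ### Gluing the levels over the shells `{x | bad(x) = T}` -/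

section glue

variable (S₀ : Finset ι)

/-- The shell of points whose set of bad coordinates (`i ∉ S₀`, `x_i ∉ K_i`) is exactly `T`. -/
def shell (T : Finset ι) : Set (Π i, G i) := {x | ∀ i, (i ∉ S₀ ∧ x i ∉ K i) ↔ i ∈ T}

omit [∀ i, MeasurableSpace (G i)] in
/-- (Ported verbatim from the HodgeCMPerL package; no docstring in the source.) -/
theorem shell_disjoint {T T' : Finset ι} (h : T ≠ T') : Disjoint (shell K S₀ T) (shell K S₀ T') :=
  Set.disjoint_left.2 fun _ hx hx' => h (Finset.ext fun i => (hx i).symm.trans (hx' i))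

omit [∀ i, MeasurableSpace (G i)] in
/-- (Ported verbatim from the HodgeCMPerL package; no docstring in the source.) -/
theorem shell_subset_box (T : Finset ι) : shell K S₀ T ⊆ box K (S₀ ∪ T) := by
  intro x hx i hi
  rw [Finset.mem_union, not_or] at hi
  by_contra h
  exact hi.2 ((hx i).1 ⟨hi.1, h⟩)

omit [∀ i, MeasurableSpace (G i)] in
/-- (Ported verbatim from the HodgeCMPerL package; no docstring in the source.) -/
theorem box_inter_shell_eq_empty {S T : Finset ι} (h : ¬ T ⊆ S) : box K S ∩ shell K S₀ T = ∅ := by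
  obtain ⟨i, hiT, hiS⟩ := Finset.not_subset.1 h
  refine Set.eq_empty_of_forall_notMem fun x hx => ?_
  exact ((hx.2 i).2 hiT).2 (hx.1 i hiS)

omit [∀ i, MeasurableSpace (G i)] in
/-- (Ported verbatim from the HodgeCMPerL package; no docstring in the source.) -/
theorem iUnion_box_inter_shell (S : Finset ι) :
    (⋃ T : Finset ι, box K S ∩ shell K S₀ T) = box K S := by
  refine subset_antisymm (iUnion_subset fun T => inter_subset_left) fun x hx => ?_
  refine mem_iUnion.2 ⟨S.filter fun i => i ∉ S₀ ∧ x i ∉ K i, hx, fun i => ?_⟩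
  rw [Finset.mem_filter]
  refine ⟨fun h => ⟨?_, h⟩, fun h => h.2⟩
  by_contra hiS
  exact h.2 (hx i hiS)

/-- (Ported verbatim from the HodgeCMPerL package; no docstring in the source.) -/
theorem measurableSet_shell [Countable ι] (hKm : ∀ i, MeasurableSet (K i)) (T : Finset ι) :
    MeasurableSet (shell K S₀ T) := by
  have : shell K S₀ T = ⋂ i, {x : Π i, G i | (i ∉ S₀ ∧ x i ∉ K i) ↔ i ∈ T} := by
    ext x; simp [shell, mem_iInter]
  rw [this]
  refine MeasurableSet.iInter fun i => ?_
  have hm : MeasurableSet {x : Π i, G i | x i ∈ K i} := measurable_pi_apply i (hKm i)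
  by_cases hT : i ∈ T <;> by_cases h0 : i ∈ S₀
  · have : {x : Π i, G i | (i ∉ S₀ ∧ x i ∉ K i) ↔ i ∈ T} = ∅ := by
      ext x; simp [hT, h0]
    rw [this]; exact MeasurableSet.empty
  · have : {x : Π i, G i | (i ∉ S₀ ∧ x i ∉ K i) ↔ i ∈ T} = {x | x i ∈ K i}ᶜ := by
      ext x; simp [hT, h0]
    rw [this]; exact hm.compl
  · have : {x : Π i, G i | (i ∉ S₀ ∧ x i ∉ K i) ↔ i ∈ T} = univ := by
      ext x; simp [hT, h0]
    rw [this]; exact MeasurableSet.univ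
  · have : {x : Π i, G i | (i ∉ S₀ ∧ x i ∉ K i) ↔ i ∈ T} = {x | x i ∈ K i} := by
      ext x; simp [hT, h0]
    rw [this]; exact hm

/-- The glued measure on `Π i, G i`: on the shell `bad = T` it is the level `S₀ ∪ T`. -/
def glued : Measure (Π i, G i) :=
  Measure.sum fun T : Finset ι => (level K ν (S₀ ∪ T)).restrict (shell K S₀ T)

variable [Countable ι] [∀ i, SigmaFinite (ν i)]

/-- **The glued measure restricted to `A_S` is the level-`S` product measure** (`S ⊇ S₀`). -/
theorem glued_restrict_box (hKm : ∀ i, MeasurableSet (K i)) (hK1 : ∀ i, i ∉ S₀ → ν i (K i) = 1)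
    {S : Finset ι} (hS : S₀ ⊆ S) : (glued K ν S₀).restrict (box K S) = level K ν S := by
  have hpS : ∀ i, i ∉ S → IsProbabilityMeasure (locK K ν i) := fun i hi =>
    isProbabilityMeasure_locK K ν (hK1 i fun h' => hi (hS h'))
  rw [glued, Measure.restrict_sum _ (measurableSet_box K hKm S)]
  have hterm : (fun T : Finset ι => ((level K ν (S₀ ∪ T)).restrict (shell K S₀ T)).restrict (box K S))
      = fun T => (level K ν S).restrict (box K S ∩ shell K S₀ T) := by
    funext T
    rw [Measure.restrict_restrict (measurableSet_box K hKm S)]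
    by_cases hT : T ⊆ S
    · rw [← level_restrict_box K ν hKm hK1 Finset.subset_union_left (Finset.union_subset hS hT),
        Measure.restrict_restrict ((measurableSet_box K hKm S).inter (measurableSet_shell K S₀ hKm T))]
      congr 1
      exact Set.inter_eq_left.2 fun x hx => shell_subset_box K S₀ T hx.2
    · rw [box_inter_shell_eq_empty K S₀ hT, Measure.restrict_empty, Measure.restrict_empty]
  rw [hterm, ← Measure.restrict_iUnion
      (fun T T' hne => (shell_disjoint K S₀ hne).mono inter_subset_right inter_subset_right)
      (fun T => (measurableSet_box K hKm S).inter (measurableSet_shell K S₀ hKm T)),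
    iUnion_box_inter_shell K S₀ S, Measure.restrict_eq_self_of_ae_mem (ae_level_mem_box K ν hKm S hpS)]

end glue

/-! ### The restricted product `Πʳ i, [G i, K i]` as a measurable space, and its measure -/

section restricted

open scoped RestrictedProduct

/-- The measurable structure on the restricted product: the trace of the product σ-algebra. -/
instance instMeasurableSpace : MeasurableSpace (Πʳ i, [G i, K i]) :=
  inferInstanceAs (MeasurableSpace {x : Π i, G i // ∀ᶠ i in cofinite, x i ∈ K i})

/-- The inclusion `Πʳ i, [G i, K i] → Π i, G i` (the coercion, named for rewriting). -/
def incl : (Πʳ i, [G i, K i]) → (Π i, G i) := fun x i => x i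

omit [∀ i, MeasurableSpace (G i)] in
/-- (Ported verbatim from the HodgeCMPerL package; no docstring in the source.) -/
@[simp] theorem incl_apply (x : Πʳ i, [G i, K i]) (i : ι) : incl K x i = x i := rfl

omit [∀ i, MeasurableSpace (G i)] in
/-- (Ported verbatim from the HodgeCMPerL package; no docstring in the source.) -/
theorem range_incl : range (incl K) = {x : Π i, G i | ∀ᶠ i in cofinite, x i ∈ K i} :=
  RestrictedProduct.range_coe _ _

omit [∀ i, MeasurableSpace (G i)] in
/-- (Ported verbatim from the HodgeCMPerL package; no docstring in the source.) -/
theorem setOf_eventually_eq_iUnion_box :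
    {x : Π i, G i | ∀ᶠ i in cofinite, x i ∈ K i} = ⋃ S : Finset ι, box K S := by
  ext x
  rw [mem_setOf_eq, mem_iUnion, Filter.eventually_cofinite]
  constructor
  · intro hfin
    exact ⟨hfin.toFinset, fun i hi => by_contra fun h => hi (hfin.mem_toFinset.2 h)⟩
  · rintro ⟨S, hS⟩
    exact S.finite_toSet.subset fun i hi => by_contra fun h => hi (hS i h)

omit [∀ i, MeasurableSpace (G i)] in
/-- (Ported verbatim from the HodgeCMPerL package; no docstring in the source.) -/
theorem box_subset_range_incl (S : Finset ι) : box K S ⊆ range (incl K) := by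
  rw [range_incl, setOf_eventually_eq_iUnion_box]
  exact subset_iUnion (fun S => box K S) S

/-- (Ported verbatim from the HodgeCMPerL package; no docstring in the source.) -/
theorem measurableEmbedding_incl [Countable ι] (hKm : ∀ i, MeasurableSet (K i)) :
    MeasurableEmbedding (incl K) := by
  have hR : MeasurableSet {x : Π i, G i | ∀ᶠ i in cofinite, x i ∈ K i} := by
    rw [setOf_eventually_eq_iUnion_box]
    exact MeasurableSet.iUnion fun S => measurableSet_box K hKm S
  exact MeasurableEmbedding.subtype_coe hR

/-- The cylinder `A_S = {x | x_i ∈ K_i for i ∉ S}` in the restricted product. -/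
def rpBox (S : Finset ι) : Set (Πʳ i, [G i, K i]) := {x | ∀ i, i ∉ S → x i ∈ K i}

omit [∀ i, MeasurableSpace (G i)] in
/-- (Ported verbatim from the HodgeCMPerL package; no docstring in the source.) -/
theorem rpBox_eq (S : Finset ι) : rpBox K S = incl K ⁻¹' box K S := rfl

omit [∀ i, MeasurableSpace (G i)] in
/-- (Ported verbatim from the HodgeCMPerL package; no docstring in the source.) -/
theorem rpBox_mono {S S' : Finset ι} (h : S ⊆ S') : rpBox K S ⊆ rpBox K S' :=
  fun _ hx i hi => hx i fun h' => hi (h h')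

omit [∀ i, MeasurableSpace (G i)] in
/-- (Ported verbatim from the HodgeCMPerL package; no docstring in the source.) -/
theorem exists_mem_rpBox (x : Πʳ i, [G i, K i]) : ∃ S : Finset ι, x ∈ rpBox K S := by
  have hx : incl K x ∈ ⋃ S : Finset ι, box K S := by
    rw [← setOf_eventually_eq_iUnion_box, ← range_incl]; exact mem_range_self x
  obtain ⟨S, hS⟩ := mem_iUnion.1 hx
  exact ⟨S, hS⟩

/-- (Ported verbatim from the HodgeCMPerL package; no docstring in the source.) -/
theorem measurableSet_rpBox [Countable ι] (hKm : ∀ i, MeasurableSet (K i)) (S : Finset ι) :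
    MeasurableSet (rpBox K S) :=
  (measurableEmbedding_incl K hKm).measurable (measurableSet_box K hKm S)

/-- **The restricted product measure** `∏'_i (ν_i ; K_i)` on `Πʳ i, [G i, K i]` (exceptional set `S₀`). -/
def rpMeasure (S₀ : Finset ι) : Measure (Πʳ i, [G i, K i]) := Measure.comap (incl K) (glued K ν S₀)

/-! #### The compact factor `C S = Π_{i∉S} K_i`, its mass-one measure, and the gluing map `e S` -/

variable (hKne : ∀ i, (K i).Nonempty)

/-- A probability measure on the subtype `K_i`: `ν_i|K_i` when `ν_i(K_i) = 1` (the case `i ∉ S₀`),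
else (irrelevant levels) a Dirac mass. -/
def kap (i : ι) : Measure (K i) :=
  if ν i (K i) = 1 then Measure.comap Subtype.val (ν i)
  else Measure.dirac ⟨(hKne i).some, (hKne i).some_mem⟩

/-- (Ported verbatim from the HodgeCMPerL package; no docstring in the source.) -/
theorem isProbabilityMeasure_kap (hKm : ∀ i, MeasurableSet (K i)) (i : ι) :
    IsProbabilityMeasure (kap K ν hKne i) := by
  unfold kap
  split_ifs with h
  · refine ⟨?_⟩
    rw [(MeasurableEmbedding.subtype_coe (hKm i)).comap_apply, image_univ, Subtype.range_coe, h]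
  · infer_instance

/-- (Ported verbatim from the HodgeCMPerL package; no docstring in the source.) -/
theorem map_val_kap {i : ι} (hKm : MeasurableSet (K i)) (h1 : ν i (K i) = 1) :
    (kap K ν hKne i).map Subtype.val = locK K ν i := by
  rw [kap, if_pos h1, (MeasurableEmbedding.subtype_coe hKm).map_comap, Subtype.range_coe]
  rfl

/-- The mass-one measure `ρ_S = ⨂_{i∉S} κ_i` on the compact factor `C S = Π_{i∉S} K_i`. -/
def rho (S : Finset ι) : Measure ((i : {i // i ∉ S}) → K i) :=
  Measure.infinitePi fun i : {i // i ∉ S} => kap K ν hKne i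

/-- (Ported verbatim from the HodgeCMPerL package; no docstring in the source.) -/
theorem isProbabilityMeasure_rho (hKm : ∀ i, MeasurableSet (K i)) (S : Finset ι) :
    IsProbabilityMeasure (rho K ν hKne S) := by
  haveI : ∀ i : {i // i ∉ S}, IsProbabilityMeasure (kap K ν hKne i) :=
    fun i => isProbabilityMeasure_kap K ν hKne hKm i
  unfold rho; infer_instance

/-- The gluing map `e_S : (Π_{i∈S} G_i) × (Π_{i∉S} K_i) → Πʳ i, [G i, K i]`. -/
def glue (S : Finset ι) (p : ((i : {i // i ∈ S}) → G i) × ((i : {i // i ∉ S}) → K i)) :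
    Πʳ i, [G i, K i] :=
  RestrictedProduct.mk ((split S).symm (p.1, fun i => (p.2 i : G i)))
    (Filter.eventually_cofinite.2 (S.finite_toSet.subset fun i hi => by
      by_contra h
      exact hi (by rw [split_symm_apply_of_not_mem (G := G) S _ h]; exact (p.2 ⟨i, h⟩).2)))

omit [∀ i, MeasurableSpace (G i)] in
/-- (Ported verbatim from the HodgeCMPerL package; no docstring in the source.) -/
theorem incl_glue (S : Finset ι) (p : ((i : {i // i ∈ S}) → G i) × ((i : {i // i ∉ S}) → K i)) :
    incl K (glue K S p) = (split S).symm (p.1, fun i => (p.2 i : G i)) := rfl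

omit [∀ i, MeasurableSpace (G i)] in
/-- (Ported verbatim from the HodgeCMPerL package; no docstring in the source.) -/
theorem incl_comp_glue (S : Finset ι) :
    incl K ∘ glue K S = (split S).symm ∘ Prod.map id (fun z i => ((z i : K (i : ι)) : G i)) := rfl

/-- `K_i`-valued truncation of a point of `G_i` (the default value is never used on `A_S`). -/
def projK (i : ι) (g : G i) : K i :=
  if h : g ∈ K i then ⟨g, h⟩ else ⟨(hKne i).some, (hKne i).some_mem⟩

/-- (Ported verbatim from the HodgeCMPerL package; no docstring in the source.) -/
theorem measurable_projK {i : ι} (hKm : MeasurableSet (K i)) : Measurable (projK K hKne i) := by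
  refine (MeasurableEmbedding.subtype_coe hKm).measurable_comp_iff.1 ?_
  have : (Subtype.val ∘ projK K hKne i) = fun g => if g ∈ K i then g else (hKne i).some := by
    funext g; simp only [comp_apply, projK]; split_ifs <;> rfl
  rw [this]
  exact Measurable.ite hKm measurable_id measurable_const

/-- The inverse of the gluing map on `A_S`. -/
def unglue (S : Finset ι) (x : Πʳ i, [G i, K i]) :
    ((i : {i // i ∈ S}) → G i) × ((i : {i // i ∉ S}) → K i) :=
  (fun i => x i, fun i => projK K hKne i (x i))

omit [∀ i, MeasurableSpace (G i)] in
/-- (Ported verbatim from the HodgeCMPerL package; no docstring in the source.) -/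
theorem unglue_glue (S : Finset ι) : LeftInverse (unglue K hKne S) (glue K S) := by
  rintro ⟨y, z⟩
  refine Prod.ext (funext fun i => ?_) (funext fun i => ?_)
  · show (split S).symm (y, fun i => (z i : G i)) i = y i
    rw [split_symm_apply_of_mem (G := G) S _ i.2]
  · show projK K hKne i ((split S).symm (y, fun i => (z i : G i)) i) = z i
    rw [split_symm_apply_of_not_mem (G := G) S _ i.2, projK, dif_pos (z i).2]

omit [∀ i, MeasurableSpace (G i)] in
include hKne in
/-- (Ported verbatim from the HodgeCMPerL package; no docstring in the source.) -/
theorem range_glue (S : Finset ι) : range (glue K S) = rpBox K S := by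
  refine subset_antisymm ?_ fun x hx => ⟨unglue K hKne S x, ?_⟩
  · rintro _ ⟨p, rfl⟩ i hi
    show (split S).symm (p.1, fun i => (p.2 i : G i)) i ∈ K i
    rw [split_symm_apply_of_not_mem (G := G) S _ hi]
    exact (p.2 ⟨i, hi⟩).2
  · refine RestrictedProduct.ext _ _ fun i => ?_
    show (split S).symm ((unglue K hKne S x).1, fun i => ((unglue K hKne S x).2 i : G i)) i = x i
    by_cases hi : i ∈ S
    · rw [split_symm_apply_of_mem (G := G) S _ hi]; rfl
    · rw [split_symm_apply_of_not_mem (G := G) S _ hi]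
      show (projK K hKne i (x i) : G i) = x i
      rw [projK, dif_pos (hx i hi)]

variable [Countable ι]

/-- (Ported verbatim from the HodgeCMPerL package; no docstring in the source.) -/
theorem measurable_incl (hKm : ∀ i, MeasurableSet (K i)) : Measurable (incl K) :=
  (measurableEmbedding_incl K hKm).measurable

omit [Countable ι] in
/-- (Ported verbatim from the HodgeCMPerL package; no docstring in the source.) -/
theorem measurable_valPi (S : Finset ι) :
    Measurable (fun (z : (i : {i // i ∉ S}) → K i) (i : {i // i ∉ S}) => ((z i : K (i : ι)) : G i)) :=
  measurable_pi_lambda _ fun i => measurable_subtype_coe.comp (measurable_pi_apply i)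

/-- (Ported verbatim from the HodgeCMPerL package; no docstring in the source.) -/
theorem measurable_glue (hKm : ∀ i, MeasurableSet (K i)) (S : Finset ι) : Measurable (glue K S) := by
  refine (measurableEmbedding_incl K hKm).measurable_comp_iff.1 ?_
  rw [incl_comp_glue]
  exact (measurable_split_symm S).comp (measurable_id.prodMap (measurable_valPi K S))

/-- (Ported verbatim from the HodgeCMPerL package; no docstring in the source.) -/
theorem measurable_unglue (hKm : ∀ i, MeasurableSet (K i)) (S : Finset ι) :
    Measurable (unglue K hKne S) := by
  refine Measurable.prodMk (measurable_pi_lambda _ fun i => ?_) (measurable_pi_lambda _ fun i => ?_)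
  · exact (measurable_pi_apply (i : ι)).comp (measurable_incl K hKm)
  · exact (measurable_projK K hKne (hKm i)).comp ((measurable_pi_apply (i : ι)).comp (measurable_incl K hKm))

include hKne in
/-- (Ported verbatim from the HodgeCMPerL package; no docstring in the source.) -/
theorem measurableEmbedding_glue (hKm : ∀ i, MeasurableSet (K i)) (S : Finset ι) :
    MeasurableEmbedding (glue K S) :=
  MeasurableEmbedding.of_measurable_inverse (measurable_glue K hKm S)
    (by rw [range_glue K hKne]; exact measurableSet_rpBox K hKm S)
    (measurable_unglue K hKne hKm S) (unglue_glue K hKne S)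


-- port_pkg: scope closed for this part
end restricted
end HodgeCM.PerL34.RestrictedMeasure
end
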